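import Mathlib
import HarnessLib
import Literature.Geometry.Lorentzian.Stationary
import Literature.Geometry.Lorentzian.KillingComovingChart
import Literature.Geometry.Lorentzian.StationaryComovingChart
import Literature.Geometry.Lorentzian.MaxAtlasChart
import Literature.Geometry.Manifold.CommutingFlowBoxChart

/-!
# `NonTrappingHawkingRigidity` (crux stmt-FinalStateConjecture-13896), line `azimuthal-partial-analyticity` — stub `stub_commutingKillingFlowBox` (N3a)

Registered stub of the lead's skeleton `Cruxes/NonTrappingHawkingRigidity/Lines/azimuthal_partial_analyticity.lean`
(namespace `…Cruxes.NonTrappingHawkingRigidity.AzimuthalPartialAnalyticity`, `Holds.stub_commutingKillingFlowBox`).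
The statement below is the REGISTERED signature, letter for letter (Literature vocabulary only).

## What is proved

Stub N3a, the soft last step of the engine of the line: for every stationary black-hole spacetime
`𝓑` (no telescope hypothesis: `T = 𝓑.killing` is a global smooth Killing field), every open `O`,
every vector field `Y` smooth and Killing on `O` with `[T, Y] = 0` on `O`, and every `q ∈ O` at
which `T q, Y q` are linearly independent and span a plane containing a timelike vector, the
metric is *two-variable analytic at `q`*: there is a chart `ψ` of the maximal `C^∞` atlas around
`q` whose coordinate plane `span{∂₀, ∂₁}` is timelike at `q` and whose metric components
`G_{ab}(p) = g_{ψ⁻¹ p}(dψ⁻¹_p a, dψ⁻¹_p b)` are, pair by pair, `C^∞` on a coordinate ball about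
`ψ q` inside `ψ.target` with uniform bounds `‖Dᵏ G_{ab}(z)(v₁, …, v_k)‖ ≤ M Cᵏ k!` for all
directions `vᵢ ∈ {𝐞₀, 𝐞₁}`.

## Proof

1. JOINT FLOW BOX (Lee 2012, Thm. 9.46, canonical form for commuting vector fields, `k = 2`):
   `Literature.Geometry.Manifold.exists_chart_mfderiv_eq_const_of_mlieBracket_eq_zero`
   (`CommutingFlowBoxChart.lean`, landed for this stub together with its Banach-space core
   `CommutingFlowBox.lean`) gives a chart `ψ₀` of the maximal atlas about `q`, `ψ₀.source ⊆ O`, in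
   which `T` and `Y` are constant, linearly independent fields `e₁, e₂`; a linear automorphism `L`
   of `E4` with `L e₁ = 𝐞₀`, `L e₂ = 𝐞₁` (basis extension in `ℝ⁴`,
   `exists_continuousLinearEquiv_apply_eq_pair`) then gives `ψ = L ∘ ψ₀` with `∂₀ = T`, `∂₁ = Y`
   on `ψ.source` (Lee 2012, Thm. 9.22, linear change of coordinates;
   `transHomeomorph_continuousLinearEquiv_mem_maximalAtlas`).
2. TIMELIKE PLANE: `a ∂₀|_q + b ∂₁|_q = a T q + b Y q`, timelike for the given `a, b`.
3. CONSTANT COMPONENTS (O'Neill 1983, Ch. 9, Prop. 9.25; Müller zum Hagen's comoving coordinates):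
   `PseudoRiemannianMetric.hasDerivAt_val_coordVector_of_killing_at` gives
   `∂₀ G_{ab} = ∂₁ G_{ab} = 0` on `ψ.target` from the Killing equations of `T` (everywhere) and
   `Y` (on `O ⊇ ψ.source`); the components are `C^∞` on the target (the metric transported to a
   chart of the maximal atlas, `MaxAtlasChart.isMetricOn_metricRepr`).
4. BOUNDS (Krantz–Parks 2002, Prop. 2.2.10, trivially): on the open target every iterated
   derivative of order `k ≥ 1` in directions from `{𝐞₀, 𝐞₁}` vanishes
   (`iteratedFDerivWithin_succ_apply_right`, `iteratedFDerivWithin_clm_apply_const_apply`, and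
   the vanishing of `p ↦ DG(p) 𝐞ᵢ`), and order `0` is bounded by continuity on a compact ball:
   `C = 1`, `M = max (sup |G_{ab}|) 0`.

## References

* J. M. Lee, *Introduction to Smooth Manifolds*, 2nd ed. (2012), Thm. 9.22, Thm. 9.46.
  [LeeSmoothManifolds2013]
* B. O'Neill, *Semi-Riemannian geometry* (1983), Ch. 9, Prop. 9.25. [ONeill1983]
* S. G. Krantz, H. R. Parks, *A Primer of Real Analytic Functions*, 2nd ed. (2002), Prop. 2.2.10.
  [KrantzParks2002]
-/

noncomputable section

-- D-0017: single-problem summit, `Summit.<S>.<S>.…` by design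
set_option linter.dupNamespace false

namespace Summit.FinalStateConjecture.FinalStateConjecture.Theorems.NonTrappingHawkingRigidity.AzimuthalPartialAnalyticity

open Set Filter Function Bundle Literature.Geometry.Lorentzian
open scoped Manifold ContDiff Topology Nat

/-- **Linear change of coordinates of `ℝ⁴` taking an independent pair to `(𝐞₀, 𝐞₁)`** (the linear
step of Lee 2012, Thm. 9.22/9.46): extend `(e₁, e₂)` to a basis of `E4`
(`exists_linearIndependent_cons_of_lt_finrank`) and map it to a permutation of the standard
basis. [cite: LeeSmoothManifolds2013, Thm. 9.46] -/
theorem exists_continuousLinearEquiv_apply_eq_pair {e₁ e₂ : E4}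
    (h : LinearIndependent ℝ ![e₁, e₂]) :
    ∃ L : E4 ≃L[ℝ] E4, L e₁ = EuclideanSpace.single 0 1 ∧ L e₂ = EuclideanSpace.single 1 1 := by
  have h4 : Module.finrank ℝ E4 = 4 := finrank_euclideanSpace_fin
  obtain ⟨x, hx⟩ := exists_linearIndependent_cons_of_lt_finrank h (by rw [h4]; norm_num)
  obtain ⟨x', hx'⟩ := exists_linearIndependent_cons_of_lt_finrank hx (by rw [h4]; norm_num)
  set b : Module.Basis (Fin 4) ℝ E4 :=
    basisOfLinearIndependentOfCardEqFinrank hx' (by rw [h4]; simp) with hb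
  have hb2 : b 2 = e₁ := by
    rw [hb, coe_basisOfLinearIndependentOfCardEqFinrank]
    rfl
  have hb3 : b 3 = e₂ := by
    rw [hb, coe_basisOfLinearIndependentOfCardEqFinrank]
    rfl
  set σ : Fin 4 ≃ Fin 4 := (Equiv.swap 0 2).trans (Equiv.swap 1 3) with hσ
  have hσ2 : σ 2 = 0 := by decide
  have hσ3 : σ 3 = 1 := by decide
  set L : E4 ≃ₗ[ℝ] E4 := b.equiv (PiLp.basisFun 2 ℝ (Fin 4)) σ with hL
  refine ⟨L.toContinuousLinearEquiv, ?_, ?_⟩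
  · show L e₁ = EuclideanSpace.single 0 1
    rw [← hb2, hL, Module.Basis.equiv_apply, hσ2, PiLp.basisFun_apply]
  · show L e₂ = EuclideanSpace.single 1 1
    rw [← hb3, hL, Module.Basis.equiv_apply, hσ3, PiLp.basisFun_apply]

/-- **Stub N3a · commutingKillingFlowBox** (two commuting Killing fields with timelike span give
two-variable analyticity; the soft last step of the engine of line `azimuthal-partial-analyticity`
of `NonTrappingHawkingRigidity`). For every `𝓑`, every open `O`, every vector field `Y` smooth and
Killing on `O` with `[T, Y] = 0` on `O` (`T = 𝓑.killing`), and every `q ∈ O` at which `T q, Y q`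
are linearly independent and span a plane containing a timelike vector: a chart `ψ` of the maximal
`C^∞` atlas around `q` with `span{∂₀, ∂₁}` timelike at `q` and, pair by pair, `C^∞` components
obeying `‖Dᵏ G_{ab}(z)(v)‖ ≤ M Cᵏ k!` for `vᵢ ∈ {𝐞₀, 𝐞₁}` on a coordinate ball inside `ψ.target`.
Proof: joint flow box of `(T, Y)` (Lee 2012, Thm. 9.46: `∂₀ = T`, `∂₁ = Y`), Killing's equation
for coordinate fields (`∂₀ G_{ab} = ∂₁ G_{ab} = 0`, O'Neill 1983, Prop. 9.25), so all iterated
derivatives of order `≥ 1` in these directions vanish and order `0` is bounded by continuity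
(`C = 1`). [cite: LeeSmoothManifolds2013, Thm. 9.46] [cite: ONeill1983, Ch. 9, Prop. 9.25]
[cite: KrantzParks2002, Prop. 2.2.10] -/
theorem stub_commutingKillingFlowBox :
    ∀ (𝓑 : StationaryAFBlackHole.{0}) [𝓑.metric.HasLeviCivita],
      ∀ (O : Set 𝓑.carrier) (Y : Π x : 𝓑.carrier, TangentSpace (𝓡 4) x), IsOpen O →
      (ContMDiffOn (𝓡 4) ((𝓡 4).prod 𝓘(ℝ, E4)) ((⊤ : ℕ∞) : WithTop ℕ∞)
          (fun x ↦ (Bundle.TotalSpace.mk' E4 x (Y x) : TangentBundle (𝓡 4) 𝓑.carrier)) O ∧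
        (∀ x ∈ O, ∀ v w : TangentSpace (𝓡 4) x,
          𝓑.metric.val x (𝓑.metric.leviCivita Y x v) w + 𝓑.metric.val x v (𝓑.metric.leviCivita Y x w) = 0) ∧
        ∀ x ∈ O, VectorField.mlieBracket (𝓡 4) 𝓑.killing Y x = 0) →
      ∀ q ∈ O, (∀ a b : ℝ, a • 𝓑.killing q + b • Y q = 0 → a = 0 ∧ b = 0) →
      (∃ a b : ℝ, 𝓑.metric.val q (a • 𝓑.killing q + b • Y q) (a • 𝓑.killing q + b • Y q) < 0) →
      (∃ ψ ∈ IsManifold.maximalAtlas (𝓡 4) ((⊤ : ℕ∞) : WithTop ℕ∞) 𝓑.carrier, q ∈ ψ.source ∧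
        (∃ a b : ℝ, 𝓑.metric.val q
            (a • mfderiv 𝓘(ℝ, E4) (𝓡 4) ψ.symm (ψ q) (EuclideanSpace.single 0 1) +
              b • mfderiv 𝓘(ℝ, E4) (𝓡 4) ψ.symm (ψ q) (EuclideanSpace.single 1 1))
            (a • mfderiv 𝓘(ℝ, E4) (𝓡 4) ψ.symm (ψ q) (EuclideanSpace.single 0 1) +
              b • mfderiv 𝓘(ℝ, E4) (𝓡 4) ψ.symm (ψ q) (EuclideanSpace.single 1 1)) < 0) ∧
        ∀ a b : E4, ∃ δ > (0 : ℝ), ∃ M C : ℝ, 0 ≤ M ∧ 0 ≤ C ∧ Metric.ball (ψ q) δ ⊆ ψ.target ∧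
          ContDiffOn ℝ ((⊤ : ℕ∞) : WithTop ℕ∞)
            (fun p : E4 ↦ 𝓑.metric.val (ψ.symm p) (mfderiv 𝓘(ℝ, E4) (𝓡 4) ψ.symm p a) (mfderiv 𝓘(ℝ, E4) (𝓡 4) ψ.symm p b)) (Metric.ball (ψ q) δ) ∧
          ∀ z ∈ Metric.ball (ψ q) δ, ∀ (k : ℕ) (v : Fin k → E4),
            (∀ i, v i = EuclideanSpace.single 0 1 ∨ v i = EuclideanSpace.single 1 1) →
            ‖iteratedFDeriv ℝ k
                (fun p : E4 ↦ 𝓑.metric.val (ψ.symm p) (mfderiv 𝓘(ℝ, E4) (𝓡 4) ψ.symm p a) (mfderiv 𝓘(ℝ, E4) (𝓡 4) ψ.symm p b)) z v‖ ≤ M * C ^ k * k !) := by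
  intro 𝓑 _ O Y hO hOY q hq hind htl
  obtain ⟨hY, hYKill, hTY⟩ := hOY
  have hKF := 𝓑.isStationaryKilling.isKillingField
  /- Step 1 (joint flow box, Lee 2012 Thm. 9.46): a chart `ψ₀` of the maximal atlas about `q`,
  `ψ₀.source ⊆ O`, in which `T` and `Y` are the constant independent fields `e₁, e₂`. -/
  have hind' : LinearIndependent ℝ ![𝓑.killing q, Y q] := LinearIndependent.pair_iff.2 hind
  obtain ⟨ψ₀, hψ₀, hqψ₀, hψ₀O, e₁, e₂, he, -, -, h1', h2'⟩ :=
    Literature.Geometry.Manifold.exists_chart_mfderiv_eq_const_of_mlieBracket_eq_zero (E := E4)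
      hO hKF.contMDiff.contMDiffOn hY hTY hq hind'
  -- the linear change of coordinates `L e₁ = 𝐞₀`, `L e₂ = 𝐞₁`, and `ψ = L ∘ ψ₀`
  obtain ⟨L, hL₁, hL₂⟩ := exists_continuousLinearEquiv_apply_eq_pair he
  set ψ := ψ₀.transHomeomorph L.toHomeomorph with hψdef
  have hψ : ψ ∈ IsManifold.maximalAtlas (𝓡 4) ((⊤ : ℕ∞) : WithTop ℕ∞) 𝓑.carrier :=
    transHomeomorph_continuousLinearEquiv_mem_maximalAtlas hψ₀ L
  have hsrc : ψ.source = ψ₀.source := OpenPartialHomeomorph.transHomeomorph_source _ _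
  have htgt : ψ.target = L.toHomeomorph.symm ⁻¹' ψ₀.target :=
    OpenPartialHomeomorph.transHomeomorph_target _ _
  have hψapp : ∀ x, ψ x = L (ψ₀ x) := fun x ↦ rfl
  have hψsymm : ∀ p, ψ.symm p = ψ₀.symm (L.symm p) := fun p ↦ rfl
  have hd₀ := mdifferentiable_of_mem_maximalAtlas' hψ₀
  have hLd' : ∀ p : E4, MDifferentiableAt 𝓘(ℝ, E4) 𝓘(ℝ, E4) (L.symm : E4 → E4) p := fun p ↦
    L.symm.hasMFDerivAt.mdifferentiableAt
  have hqψ : q ∈ ψ.source := by rw [hsrc]; exact hqψ₀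
  have hqt : ψ q ∈ ψ.target := ψ.map_source hqψ
  have hψO : ψ.source ⊆ O := fun x hx ↦ hψ₀O (by rwa [hsrc] at hx)
  -- chain rule for `ψ⁻¹ = ψ₀⁻¹ ∘ L⁻¹` on the chart target
  have hchain : ∀ p ∈ ψ.target, ∀ a : E4, mfderiv 𝓘(ℝ, E4) (𝓡 4) ψ.symm p a =
      mfderiv 𝓘(ℝ, E4) (𝓡 4) ψ₀.symm (L.symm p) (L.symm a) := by
    intro p hp a
    have hcomp : (ψ.symm : E4 → 𝓑.carrier) = ψ₀.symm ∘ (L.symm : E4 → E4) := funext hψsymm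
    have hp₀ : L.symm p ∈ ψ₀.target := by rw [htgt] at hp; exact hp
    rw [hcomp, mfderiv_comp p (hd₀.mdifferentiableAt_symm hp₀) (hLd' p), L.symm.mfderiv_eq]
    rfl
  -- the coordinate fields: `∂₀ = T` and `∂₁ = Y` on `ψ.source`
  have hc0 : ∀ x ∈ ψ.source, mfderiv 𝓘(ℝ, E4) (𝓡 4) ψ.symm (ψ x)
      (EuclideanSpace.single (0 : Fin 4) (1 : ℝ) : E4) = 𝓑.killing x := by
    intro x hx
    rw [hchain _ (ψ.map_source hx), hψapp, L.symm_apply_apply, ← hL₁, L.symm_apply_apply]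
    exact h1' x (hsrc ▸ hx)
  have hc1 : ∀ x ∈ ψ.source, mfderiv 𝓘(ℝ, E4) (𝓡 4) ψ.symm (ψ x)
      (EuclideanSpace.single (1 : Fin 4) (1 : ℝ) : E4) = Y x := by
    intro x hx
    rw [hchain _ (ψ.map_source hx), hψapp, L.symm_apply_apply, ← hL₂, L.symm_apply_apply]
    exact h2' x (hsrc ▸ hx)
  refine ⟨ψ, hψ, hqψ, ?_, fun a b ↦ ?_⟩
  · /- Step 2: the coordinate plane at `q` is `span{T q, Y q}`, which contains a timelike
    vector. -/
    obtain ⟨a, b, hab⟩ := htl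
    refine ⟨a, b, ?_⟩
    rw [hc0 q hqψ, hc1 q hqψ]
    exact hab
  · /- Step 3: the component `G = G_{ab}` is `C^∞` on the target and `∂₀ G = ∂₁ G = 0` there. -/
    set G : E4 → ℝ := fun p : E4 ↦ 𝓑.metric.val (ψ.symm p)
      (mfderiv 𝓘(ℝ, E4) (𝓡 4) ψ.symm p a) (mfderiv 𝓘(ℝ, E4) (𝓡 4) ψ.symm p b) with hGdef
    have hGs : ContDiffOn ℝ ∞ G ψ.target := by
      have hM := (MaxAtlasChart.isMetricOn_metricRepr 𝓑.metric.toPseudoRiemannianMetric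
        hψ).contDiffOn
      have h1 : ContDiffOn ℝ ∞ (fun p ↦ MaxAtlasChart.metricRepr
          𝓑.metric.toPseudoRiemannianMetric hψ p a b) ψ.target :=
        (hM.clm_apply contDiffOn_const).clm_apply contDiffOn_const
      refine h1.congr fun p hp ↦ ?_
      have e1 := DFunLike.congr_fun (DFunLike.congr_fun
        (MaxAtlasChart.metric_val_eq_repr 𝓑.metric.toPseudoRiemannianMetric hψ ⟨p, hp⟩) a) b
      have e2 : ∀ w : E4, mfderiv 𝓘(ℝ, E4) 𝓘(ℝ, E4) (MaxAtlasChart.inv ψ) ⟨p, hp⟩ w =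
          mfderiv 𝓘(ℝ, E4) (𝓡 4) ψ.symm p w := fun w ↦ by
        rw [MaxAtlasChart.mfderiv_inv hψ]
        rfl
      show 𝓑.metric.val (ψ.symm p) (mfderiv 𝓘(ℝ, E4) (𝓡 4) ψ.symm p a)
        (mfderiv 𝓘(ℝ, E4) (𝓡 4) ψ.symm p b) = _
      rw [← e2 a, ← e2 b]
      exact e1
    -- Killing's equation for the coordinate fields `∂₀ = T`, `∂₁ = Y`
    have hD : ∀ p ∈ ψ.target, ∀ w : E4, (w = EuclideanSpace.single (0 : Fin 4) (1 : ℝ) ∨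
        w = EuclideanSpace.single (1 : Fin 4) (1 : ℝ)) →
        HasDerivAt (fun t : ℝ ↦ G (p + t • w)) 0 0 := by
      intro p hp w hw
      obtain ⟨x, hx, rfl⟩ : ∃ x ∈ ψ.source, ψ x = p :=
        ⟨ψ.symm p, ψ.map_target hp, ψ.right_inv hp⟩
      rcases hw with rfl | rfl
      · exact PseudoRiemannianMetric.hasDerivAt_val_coordVector_of_killing_at
          (g := 𝓑.metric.toPseudoRiemannianMetric) hψ hc0 hx (hKF.val_leviCivita_add x) a b
      · exact PseudoRiemannianMetric.hasDerivAt_val_coordVector_of_killing_at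
          (g := 𝓑.metric.toPseudoRiemannianMetric) hψ hc1 hx (hYKill x (hψO hx)) a b
    have hfd : ∀ z ∈ ψ.target, ∀ w : E4, (w = EuclideanSpace.single (0 : Fin 4) (1 : ℝ) ∨
        w = EuclideanSpace.single (1 : Fin 4) (1 : ℝ)) → fderiv ℝ G z w = 0 := by
      intro z hz w hw
      have hGd : DifferentiableAt ℝ G z :=
        (hGs.differentiableOn (by simp) z hz).differentiableAt (ψ.open_target.mem_nhds hz)
      have hline : HasDerivAt (fun t : ℝ ↦ z + t • w) w 0 := by
        simpa using ((hasDerivAt_id (0 : ℝ)).smul_const w).const_add z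
      have hcomp : HasDerivAt (fun t : ℝ ↦ G (z + t • w)) (fderiv ℝ G z w) 0 :=
        HasFDerivAt.comp_hasDerivAt_of_eq (0 : ℝ) hGd.hasFDerivAt hline (by simp)
      exact hcomp.unique (hD z hz w hw)
    /- Step 4: bounds on a ball — higher derivatives in the directions `𝐞₀, 𝐞₁` vanish, order
    `0` is bounded by continuity on a compact ball. -/
    obtain ⟨δ₀, hδ₀, hball₀⟩ := Metric.isOpen_iff.1 ψ.open_target (ψ q) hqt
    have hBt : Metric.ball (ψ q) (δ₀ / 2) ⊆ ψ.target :=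
      (Metric.ball_subset_ball (half_le_self hδ₀.le)).trans hball₀
    have hCt : Metric.closedBall (ψ q) (δ₀ / 2) ⊆ ψ.target :=
      (Metric.closedBall_subset_ball (half_lt_self hδ₀)).trans hball₀
    obtain ⟨C₀, hC₀⟩ := (isCompact_closedBall (ψ q) (δ₀ / 2)).exists_bound_of_continuousOn
      (hGs.continuousOn.mono hCt)
    refine ⟨δ₀ / 2, half_pos hδ₀, max C₀ 0, 1, le_max_right _ _, zero_le_one, hBt, hGs.mono hBt,
      fun z hz k v hv ↦ ?_⟩
    rw [one_pow, mul_one]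
    cases k with
    | zero =>
      rw [iteratedFDeriv_zero_apply, Nat.factorial_zero, Nat.cast_one, mul_one]
      exact (hC₀ z (Metric.ball_subset_closedBall hz)).trans (le_max_left _ _)
    | succ n =>
      have hS := ψ.open_target
      have hzS : z ∈ ψ.target := hBt hz
      have hU : UniqueDiffOn ℝ ψ.target := hS.uniqueDiffOn
      have hc : ContDiffOn ℝ ∞ (fun y ↦ fderivWithin ℝ G ψ.target y) ψ.target :=
        hGs.fderivWithin hU (le_of_eq rfl)
      have key := iteratedFDerivWithin_clm_apply_const_apply hU hc (i := n)
        (by exact_mod_cast le_top) hzS (u := v (Fin.last n)) (m := Fin.init v)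
      have hvan : EqOn (fun y ↦ fderivWithin ℝ G ψ.target y (v (Fin.last n)))
          (fun _ ↦ (0 : ℝ)) ψ.target := by
        intro y hy
        show fderivWithin ℝ G ψ.target y (v (Fin.last n)) = 0
        rw [fderivWithin_of_isOpen hS hy]
        exact hfd y hy _ (hv (Fin.last n))
      have hzero : iteratedFDeriv ℝ (n + 1) G z v = 0 := by
        rw [← iteratedFDerivWithin_of_isOpen (n + 1) hS hzS,
          iteratedFDerivWithin_succ_apply_right hU hzS, ← key,
          iteratedFDerivWithin_congr hvan hzS, iteratedFDerivWithin_fun_zero]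
        rfl
      rw [hzero, norm_zero]
      exact mul_nonneg (le_max_right _ _) (by positivity)

/- WORKLOG
- v1: joint flow box of (T, Y) via the new Literature files CommutingFlowBox.lean (p145722) and CommutingFlowBoxChart.lean (p146969);
  linear change of coordinates by basis extension in E4; Killing ⇒ ∂₀G = ∂₁G = 0 on the target
  (hasDerivAt_val_coordVector_of_killing_at); smoothness from MaxAtlasChart.isMetricOn_metricRepr;
  higher directional derivatives vanish (iteratedFDerivWithin API), order 0 bounded on a compact ball.
-/

end Summit.FinalStateConjecture.FinalStateConjecture.Theorems.NonTrappingHawkingRigidity.AzimuthalPartialAnalyticity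

end
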